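import Mathlib
import Literature.NumberTheory.LFunctions.Zhang2022.Section4ContourShift
import HarnessLib

/-!
# Zhang (2022), §4 Lemma 4.4 (proof): the contour shift for (4.9) (typed node
# `Section4.Shift49`) DISCHARGED, with the holomorphy of the tail `Σ_{n>P²} ν(n)ψ̄(n)n^{−z}`

Topic `Literature/NumberTheory/LFunctions/Zhang2022` (Landau–Siegel audit tree; verdict-neutral).
Y. Zhang, *Discrete mean estimates and the Landau–Siegel zero*, arXiv:2211.02515v1 (2022)
[Zhang2022LandauSiegel] — **an unrefereed manuscript under adjudication.** [Z22 pp.20–21,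
tex L1115–L1125]:

> The estimate (4.9) follows by moving the contour of integration to the vertical segments
> `w = −σ − 10 + iv` with `|v| < 𝓛²⁰`, `w = −σ − 1/2 + iv` with `|v| ≥ 𝓛²⁰`, and to the two
> connecting horizontal segments `w = u ± i𝓛²⁰` with `−σ − 10 ≤ u ≤ −σ − 1/2`, and applying (4.5)
> and trivial bounds for `ω₁(w)` and the involved sum.

The typed node `Section4.Shift49` is the contour IDENTITY (no pole is crossed: `Re w ≤ −σ−1/2 < 0`).
Its integrand contains the infinite tail `Σ_{n>P²} ν(n)ψ̄(n)n^{−(1−s−w)}` (`Section4.tailSum`),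
whose holomorphy on `Re(1−s−w) > 1` (here `Re ≥ 3/2`) is the Dirichlet-series input:

* `tailSum_eq_LSeries` — `tailSum = LSeries` of the truncated coefficients `1_{n>P²}ν(n)ψ̄(n)`;
* `LSeriesSummable_tail`, `differentiableAt_tailSum`, `continuous_tailSum_line`, `norm_tailSum_le`;
* `differentiableAt_f49`, `integrable_perronIntegrand_f49`;
* `shift49_holds : Shift49` — unconditional (threshold `D ≥ ⌈e³⌉`), by Cauchy–Goursat
  (`Section4.perronLine_eq_contour`).

Nothing about Theorems 1–2 of the source or about Landau–Siegel zeros is stated or implied.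

## References

* Y. Zhang, arXiv:2211.02515v1 (2022), §4 pp. 20–21 (proof of Lemma 4.4, (4.9)).
  [cite: Zhang2022LandauSiegel, §4 Lemma 4.4 (proof)]
-/

noncomputable section

open Complex Real ComplexConjugate MeasureTheory Set intervalIntegral
open scoped Interval

namespace Literature.NumberTheory.LFunctions.Zhang2022.Section4

open Skeleton

section WithCharacter

variable {D : ℕ} [NeZero D] (χ : DirichletCharacter ℂ D) (x : Chr D)

omit [NeZero D] in
/-- **`Σ_{n>P²} ν(n)ψ̄(n)n^{−z}` is the Dirichlet series of the truncated coefficients**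
`n ↦ 1_{n>P²}ν(n)ψ̄(n)`. [cite: Zhang2022LandauSiegel, §4 (4.9)] -/
theorem tailSum_eq_LSeries (z : ℂ) :
    tailSum χ x z = LSeries (fun n => if bigP D ^ 2 < (n : ℝ) then nu χ n * psiBarFn x n else 0) z := by
  rw [tailSum, LSeries]
  refine tsum_congr fun n => ?_
  rcases eq_or_ne n 0 with rfl | hn
  · have hP : ¬ bigP D ^ 2 < ((0 : ℕ) : ℝ) := by
      rw [Nat.cast_zero, not_lt]; positivity
    rw [if_neg hP, LSeries.term_zero]
  · rw [LSeries.term_of_ne_zero hn]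
    by_cases h : bigP D ^ 2 < (n : ℝ)
    · rw [if_pos h, if_pos h, Complex.cpow_neg, div_eq_mul_inv]
    · rw [if_neg h, if_neg h, zero_div]

omit [NeZero D] in
/-- The truncated series converges absolutely for `Re z > 1`. [cite: Zhang2022LandauSiegel, §4 (4.9)] -/
theorem LSeriesSummable_tail (hq : χ.IsQuadratic) {z : ℂ} (hz : 1 < z.re) :
    LSeriesSummable (fun n => if bigP D ^ 2 < (n : ℝ) then nu χ n * psiBarFn x n else 0) z := by
  have hg := (LSeriesSummable_nu_psiBar χ x hq hz).norm
  refine Summable.of_norm_bounded hg fun n => LSeries.norm_term_le z ?_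
  by_cases h : bigP D ^ 2 < (n : ℝ)
  · rw [if_pos h]
  · rw [if_neg h, norm_zero]; exact norm_nonneg _

omit [NeZero D] in
/-- **The tail `Σ_{n>P²} ν(n)ψ̄(n)n^{−z}` is holomorphic on `Re z > 1`.** [cite: Zhang2022LandauSiegel, §4 (4.9)] -/
theorem differentiableAt_tailSum (hq : χ.IsQuadratic) {z : ℂ} (hz : 1 < z.re) :
    DifferentiableAt ℂ (tailSum χ x) z := by
  have hfun : tailSum χ x = LSeries (fun n => if bigP D ^ 2 < (n : ℝ) then nu χ n * psiBarFn x n else 0) :=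
    funext (tailSum_eq_LSeries χ x)
  rw [hfun]
  set σ₁ : ℝ := (1 + z.re) / 2 with hσ₁
  have h1 : 1 < σ₁ := by rw [hσ₁]; linarith
  have h2 : σ₁ < z.re := by rw [hσ₁]; linarith
  have hsum := LSeriesSummable_tail χ x hq (z := (σ₁ : ℂ)) (by simpa using h1)
  have habs : LSeries.abscissaOfAbsConv
      (fun n => if bigP D ^ 2 < (n : ℝ) then nu χ n * psiBarFn x n else 0) < z.re :=
    lt_of_le_of_lt hsum.abscissaOfAbsConv_le (by simpa using EReal.coe_lt_coe_iff.mpr h2)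
  exact (LSeries_hasDerivAt habs).differentiableAt

omit [NeZero D] in
/-- `|Σ_{n>P²} ν(n)ψ̄(n)n^{−z}| ≤ Σ' |ν(n)ψ̄(n)|n^{−3/2}` on `Re z = 3/2`.
[cite: Zhang2022LandauSiegel, §4 (4.9)] -/
theorem norm_tailSum_le (hq : χ.IsQuadratic) {z : ℂ} (hz : z.re = 3 / 2) :
    ‖tailSum χ x z‖ ≤ ∑' n, ‖LSeries.term
      (fun n => if bigP D ^ 2 < (n : ℝ) then nu χ n * psiBarFn x n else 0) (3 / 2 : ℝ) n‖ := by
  rw [tailSum_eq_LSeries]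
  exact norm_LSeries_le_tsum (LSeriesSummable_tail χ x hq (by simp; norm_num)) hz

omit [NeZero D] in
/-- Continuity of `v ↦ Σ_{n>P²} ν(n)ψ̄(n)n^{−(c − iv)}`-type compositions: the tail is continuous along
any vertical line in `Re > 1`. [cite: Zhang2022LandauSiegel, §4 (4.9)] -/
theorem continuous_tailSum_line (hq : χ.IsQuadratic) (s : ℂ) (a : ℝ)
    (hre : 1 < (1 - s - (a : ℂ)).re) :
    Continuous fun v : ℝ => tailSum χ x (1 - s - ((a : ℂ) + v * I)) := by
  refine continuous_iff_continuousAt.mpr fun v => ?_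
  have hz : 1 < (1 - s - ((a : ℂ) + v * I)).re := by
    simpa [Complex.sub_re] using hre
  have h2 : ContinuousAt (fun v : ℝ => 1 - s - ((a : ℂ) + (v : ℂ) * I)) v :=
    (by fun_prop : Continuous fun v : ℝ => 1 - s - ((a : ℂ) + (v : ℂ) * I)).continuousAt
  change ContinuousAt (tailSum χ x ∘ fun v : ℝ => 1 - s - ((a : ℂ) + (v : ℂ) * I)) v
  exact ContinuousAt.comp (f := fun v : ℝ => 1 - s - ((a : ℂ) + (v : ℂ) * I)) (x := v)
    (differentiableAt_tailSum χ x hq hz).continuousAt h2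

/-- `f49 = Z̃(s+·)·Σ_{n>P²}ν(n)ψ̄(n)n^{−(1−s−·)}` is holomorphic at `w` when `Im(s+w) > 0` and
`Re(1−s−w) > 1`. [cite: Zhang2022LandauSiegel, §4 (4.9)] -/
theorem differentiableAt_f49 (hq : χ.IsQuadratic) (s w : ℂ) (hw : 0 < (s + w).im)
    (hre : 1 < (1 - s - w).re) : DifferentiableAt ℂ (f49 χ x s) w := by
  have hT : DifferentiableAt ℂ (fun w : ℂ => tailSum χ x (1 - s - w)) w :=
    (differentiableAt_tailSum χ x hq hre).comp w
      (((differentiableAt_const _).sub differentiableAt_id))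
  exact (differentiableAt_tildeZW_add χ x s w hw).mul hT

/-- **The (4.9)-integrand is integrable along `Re w = −σ − 1/2`** (`s ∈ Ω₃`, `𝓛 > 0`, `α < 1/2`).
[cite: Zhang2022LandauSiegel, §4 (4.9)] -/
theorem integrable_perronIntegrand_f49 (hq : χ.IsQuadratic) (hL : 0 < ell D) {s : ℂ}
    (hs : s ∈ Omega3 D) (hα : alpha D < 1 / 2) :
    Integrable fun v : ℝ => perronIntegrand D (f49 χ x s) (((-s.re - 1 / 2 : ℝ) : ℂ) + v * I) := by
  set a : ℝ := -s.re - 1 / 2 with ha_def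
  have hs1 : 1 / 2 - alpha D < s.re := hs.1
  have ha0 : a ≠ 0 := by rw [ha_def]; linarith
  have hca : (s + (a : ℂ)).re = -1 / 2 := by simp [ha_def]; ring
  have hre : 1 < (1 - s - (a : ℂ)).re := by simp [ha_def]; linarith
  have hz' : ∀ v : ℝ, (1 - s - ((a : ℂ) + v * I)).re = 3 / 2 := fun v => by simp [ha_def]; ring
  have hZc : Continuous fun v : ℝ => tildeZW χ x (s + ((a : ℂ) + v * I)) := by
    simpa [add_assoc] using continuous_tildeZW_line χ x hca
  have hc : Continuous fun v : ℝ => f49 χ x s ((a : ℂ) + v * I) :=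
    hZc.mul (continuous_tailSum_line χ x hq s a hre)
  set M : ℝ := ∑' n, ‖LSeries.term
      (fun n => if bigP D ^ 2 < (n : ℝ) then nu χ n * psiBarFn x n else 0) (3 / 2 : ℝ) n‖ with hM
  have hM0 : 0 ≤ M := tsum_nonneg fun n => norm_nonneg _
  have hZ : ∀ v : ℝ, ‖tildeZW χ x (s + ((a : ℂ) + v * I))‖
      ≤ (‖GammaFactor.tau x.ψ‖ * (x.p : ℝ) ^ (1 / 2 : ℝ)) *
        (‖GammaFactor.tau (psiChi χ x)‖ * ((D * x.p : ℕ) : ℝ) ^ (1 / 2 : ℝ)) *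
        (1 + ‖s + (a : ℂ)‖) ^ 2 * (1 + |v|) ^ 2 := by
    intro v
    have hz : (s + ((a : ℂ) + v * I)).re = -1 / 2 := by
      rw [← add_assoc, Complex.add_re, hca]; simp
    have h1 := norm_tildeZW_le_of_re χ x hz
    have hn : ‖s + ((a : ℂ) + v * I)‖ ≤ ‖s + (a : ℂ)‖ + |v| := by
      calc ‖s + ((a : ℂ) + v * I)‖ = ‖(s + (a : ℂ)) + v * I‖ := by rw [add_assoc]
        _ ≤ ‖s + (a : ℂ)‖ + ‖(v : ℂ) * I‖ := norm_add_le _ _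
        _ = ‖s + (a : ℂ)‖ + |v| := by simp
    have h0 : 0 ≤ (‖GammaFactor.tau x.ψ‖ * (x.p : ℝ) ^ (1 / 2 : ℝ)) *
        (‖GammaFactor.tau (psiChi χ x)‖ * ((D * x.p : ℕ) : ℝ) ^ (1 / 2 : ℝ)) := by positivity
    calc ‖tildeZW χ x (s + ((a : ℂ) + v * I))‖
        ≤ _ * (1 + ‖s + ((a : ℂ) + v * I)‖) ^ 2 := h1
      _ ≤ (‖GammaFactor.tau x.ψ‖ * (x.p : ℝ) ^ (1 / 2 : ℝ)) *
          (‖GammaFactor.tau (psiChi χ x)‖ * ((D * x.p : ℕ) : ℝ) ^ (1 / 2 : ℝ)) *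
          ((1 + ‖s + (a : ℂ)‖) * (1 + |v|)) ^ 2 := by
          gcongr
          nlinarith [norm_nonneg (s + (a : ℂ)), abs_nonneg v]
      _ = _ := by ring
  refine integrable_perronIntegrand ha0 hc (A := (‖GammaFactor.tau x.ψ‖ * (x.p : ℝ) ^ (1 / 2 : ℝ)) *
      (‖GammaFactor.tau (psiChi χ x)‖ * ((D * x.p : ℕ) : ℝ) ^ (1 / 2 : ℝ)) *
      (1 + ‖s + (a : ℂ)‖) ^ 2 * M) (fun v => ?_) hL
  rw [f49, norm_mul]
  have hF := norm_tailSum_le χ x hq (hz' v)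
  calc ‖tildeZW χ x (s + ((a : ℂ) + v * I))‖ * ‖tailSum χ x (1 - s - ((a : ℂ) + v * I))‖
      ≤ (_ * (1 + |v|) ^ 2) * M :=
        mul_le_mul (hZ v) hF (norm_nonneg _) (by positivity)
    _ = _ := by ring

omit [NeZero D] in
/-- `⌈e³⌉ ≤ D` gives `3 ≤ 𝓛`. [folklore] -/
private theorem three_le_ell'' {D : ℕ} (hD : ⌈Real.exp 3⌉₊ ≤ D) : 3 ≤ ell D := by
  have h : Real.exp 3 ≤ D := le_trans (Nat.le_ceil _) (by exact_mod_cast hD)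
  exact (Real.le_log_iff_exp_le (lt_of_lt_of_le (Real.exp_pos _) h)).mpr h

omit [NeZero D] in
/-- `α = π/𝓛⁹ < 1/2` once `𝓛 ≥ 3`. [cite: Zhang2022LandauSiegel, §2 (2.10)] -/
private theorem alpha_lt_half'' {D : ℕ} (hL : 3 ≤ ell D) : alpha D < 1 / 2 := by
  rw [alpha, bigP, Real.log_exp]
  have h9 : (3 : ℝ) ^ 9 ≤ ell D ^ 9 := pow_le_pow_left₀ (by norm_num) hL 9
  rw [div_lt_iff₀ (by positivity)]
  nlinarith [Real.pi_lt_four]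

end WithCharacter

/-- **`Section4.Shift49` HOLDS** (threshold `D ≥ ⌈e³⌉`): the contour of the (4.9)-integral is moved
LEFT to `Re w = −σ − 10` inside `|Im w| < 𝓛²⁰`; no pole is crossed (`Re w ≤ −σ − 1/2 < 0`), and
the tail series stays in its half-plane of absolute convergence (`Re(1−s−w) ≥ 3/2`).
[cite: Zhang2022LandauSiegel, §4 (4.9) (proof) pp. 20–21] -/
theorem shift49_holds : Shift49 := by
  refine ⟨⌈Real.exp 3⌉₊, fun D _ χ hD hq _ x s hs => ?_⟩
  have hL3 : 3 ≤ ell D := three_le_ell'' hD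
  have hL0 : 0 < ell D := by linarith
  have hα : alpha D < 1 / 2 := alpha_lt_half'' hL3
  have hs1 : 1 / 2 - alpha D < s.re := hs.1
  have hV : 0 < ell D ^ 20 := pow_pos hL0 20
  have him : ell D ^ 20 < s.im := ell_pow_lt_im_of_mem_Omega3 hL3 hs
  refine perronLine_eq_contour (f49 χ x s) ?_ (integrable_perronIntegrand_f49 χ x hq hL0 hs hα)
  intro w hw
  have hwre : w.re ≤ -s.re - 1 / 2 := by
    have h := hw.1
    rw [Set.uIcc_of_ge (by linarith : -s.re - 10 ≤ -s.re - 1 / 2)] at h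
    exact h.2
  have hwim : -(ell D ^ 20) ≤ w.im := by
    have h := hw.2
    rw [Set.uIcc_of_le (by linarith : -(ell D ^ 20) ≤ ell D ^ 20)] at h
    exact h.1
  have hw0 : w ≠ 0 := fun h => by rw [h, Complex.zero_re] at hwre; linarith
  have hpos : 0 < (s + w).im := by rw [Complex.add_im]; linarith
  have hre : 1 < (1 - s - w).re := by
    rw [Complex.sub_re, Complex.sub_re, Complex.one_re]; linarith
  exact (differentiableAt_perronIntegrand (differentiableAt_f49 χ x hq s w hpos hre) hw0).differentiableWithinAt

/-- `Shift49` — `_holds` alias of `shift49_holds` above under the fact's exact name (appended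
2026-08-28, D-0026 bookkeeping: the proof term is the existing theorem of this file; no statement,
definition or attribute is edited; no new named fact; the ledger's debt table listed the fact
unproved). [cite: Zhang2022LandauSiegel, §4 (4.9) (proof) pp. 20–21] -/
theorem _root_.Literature.NumberTheory.LFunctions.Zhang2022.Section4.Shift49_holds : Shift49 :=
  _root_.Literature.NumberTheory.LFunctions.Zhang2022.Section4.shift49_holds

end Literature.NumberTheory.LFunctions.Zhang2022.Section4
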